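import Literature.NumberTheory.Sieve.GrimmeltMerikoski2025
import Literature.NumberTheory.Sieve.PolynomialCongruencesLemmas
import Literature.NumberTheory.Sieve.FriedlanderIwaniecPrimesCrudeBound
import Literature.NumberTheory.Sieve.DivisorBound
import HarnessLib

/-!
# Grimmelt–Merikoski 2025: the uniform root-count bound `ϱ_{a,h}(k) ≤ τ(k)²`

L. Grimmelt, J. Merikoski, *On the greatest prime factor and uniform equidistribution of quadratic
polynomials*, arXiv:2505.00493 [GrimmeltMerikoski2025].  Throughout §§5–6 (the proofs of the
Type I / Type II estimates, Theorems 1.4–1.5) the paper absorbs the local root count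
`ϱ_{a,h}(k) = #{ν mod k : aν² + h ≡ 0 (mod k)}` "with a divisor bound" (`ϱ ≺≺ 1` in the notation of
§1.3: e.g. §6 after (6.2), "using the fact that `β_n` are supported on square-free integers, we have
by the Chinese remainder theorem …", and §6.1 "by absorbing `t, n₀, n₁, n₂, m` with a divisor
bound").  This file PROVES the elementary input behind that step, uniformly in the parameters of
Theorems 1.4–1.5 (`h` square-free, `gcd(a, h) = 1`, no size conditions):

* `GM2025.rho_eq_zero_of_prime_dvd`: a prime `p ∣ k` with `p ∣ a` kills all roots;
* `GM2025.rho_prime_pow_le_one_of_dvd_right`: `p ∣ h` ⇒ `ϱ_{a,h}(p^e) ≤ 1` (here square-freeness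
  of `h` is used: a root is `≡ 0 (mod p)`, so `e ≥ 2` would force `p² ∣ h`);
* `GM2025.rho_prime_pow_le_two`: `p` odd, `p ∤ ah` ⇒ `ϱ_{a,h}(p^e) ≤ 2` (two roots `ν, ν₀` have
  `p^e ∣ (ν-ν₀)(ν+ν₀)` and `p` cannot divide both factors);
* `GM2025.rho_two_pow_le_four`: `2 ∤ ah` ⇒ `ϱ_{a,h}(2^e) ≤ 4` (the residues `mod 2^{e-1}` of two
  roots agree up to sign);
* `GM2025.rho_le_card_divisors_sq`: **`ϱ_{a,h}(k) ≤ τ(k)²` for all `k`**, by multiplicativity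
  (`polyRootCountMod_mul_of_coprime`, `PolynomialCongruencesLemmas.lean`) and `4 ≤ (e+1)²`;
* `GM2025.exists_rho_le_mul_rpow`: hence `ϱ_{a,h}(k) ≤ C_ε k^ε` with `C_ε` independent of `a, h`
  (the tree's divisor bound `exists_card_divisors_le_mul_rpow`, `DivisorBound.lean`).

These are the first (and only elementary) inputs of the proof of
`Literature.NumberTheory.Sieve.grimmeltMerikoski2025_thm15`; the theorem itself rests on the
automorphic machinery of the companion paper ([GrimmeltMerikoski2025, §6], "Theorem 2.1 of
[GMtechnical]", Kim–Sarnak `θ = 7/64`), which is not in Mathlib or the tree.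

## References

* [GrimmeltMerikoski2025] L. Grimmelt, J. Merikoski, arXiv:2505.00493, §1 (definition of
  `ϱ_{a,h}`), §6 (use of the divisor bound for `ϱ`).
* Reused from the tree: `FriedlanderIwaniecPrimes.card_le_two_of_dvd_sub_or_add`,
  `FriedlanderIwaniecPrimes.card_divisors_prime_pow` (`FriedlanderIwaniecPrimesCrudeBound.lean`),
  `polyRootCountMod_mul_of_coprime` (`PolynomialCongruencesLemmas.lean`),
  `exists_card_divisors_le_mul_rpow` (`DivisorBound.lean`).  Mathlib: `Nat.recOnPosPrimePosCoprime`,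
  `Nat.Coprime.card_divisors_mul`, `IsCoprime.dvd_of_dvd_mul_left`, `Finset.card_le_mul_card_image`.
-/

namespace Literature.NumberTheory.Sieve

open Finset Polynomial

namespace GM2025

open FriedlanderIwaniecPrimes (card_le_two_of_dvd_sub_or_add card_divisors_prime_pow)

/-! ### Unfolding and trivial bounds -/

/-- `ϱ_{a,h}(k) = #{0 ≤ ν < k : k ∣ aν² + h}`. [cite: GrimmeltMerikoski2025, §1 (definition of ϱ_{a,h})] -/
theorem rho_eq_card_filter (a h k : ℕ) :
    rho a h k = #((range k).filter fun ν : ℕ => (k : ℤ) ∣ (a : ℤ) * (ν : ℤ) ^ 2 + (h : ℤ)) := by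
  unfold rho polyRootCountMod
  congr 1
  ext ν
  simp only [mem_filter, Fin.prod_univ_one, Matrix.cons_val_fin_one, eval_add, eval_mul, eval_C,
    eval_pow, eval_X]

/-- Trivial bound `ϱ_{a,h}(k) ≤ k`. [folklore] -/
theorem rho_le (a h k : ℕ) : rho a h k ≤ k := polyRootCountMod_le _ _

/-- Junk value `ϱ_{a,h}(0) = 0`. [folklore] -/
theorem rho_zero (a h : ℕ) : rho a h 0 = 0 := Nat.le_zero.mp (rho_le a h 0)

/-- Multiplicativity in the modulus: `ϱ_{a,h}(mn) = ϱ_{a,h}(m) ϱ_{a,h}(n)` for coprime `m, n`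
(Chinese remainder theorem). [folklore] -/
theorem rho_mul_of_coprime (a h : ℕ) {m n : ℕ} (hmn : m.Coprime n) :
    rho a h (m * n) = rho a h m * rho a h n :=
  polyRootCountMod_mul_of_coprime _ hmn

/-! ### Prime powers -/

/-- If a prime `p ∣ k` divides `a` then, as `gcd(a, h) = 1`, `aν² + h ≡ h ≢ 0 (mod p)`:
`ϱ_{a,h}(k) = 0`. [folklore] -/
theorem rho_eq_zero_of_prime_dvd {a h k p : ℕ} (hp : p.Prime) (hpk : p ∣ k) (hpa : p ∣ a)
    (hah : a.Coprime h) : rho a h k = 0 := by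
  rw [rho_eq_card_filter, card_eq_zero, filter_eq_empty_iff]
  intro ν _ hdvd
  have h1 : (p : ℤ) ∣ (a : ℤ) * (ν : ℤ) ^ 2 + (h : ℤ) := (Int.natCast_dvd_natCast.2 hpk).trans hdvd
  have h2 : (p : ℤ) ∣ (a : ℤ) * (ν : ℤ) ^ 2 := (Int.natCast_dvd_natCast.2 hpa).mul_right _
  have h3 : (p : ℤ) ∣ (h : ℤ) := by
    have := dvd_sub h1 h2
    rwa [add_sub_cancel_left] at this
  exact hp.ne_one (Nat.Coprime.eq_one_of_dvd (hah.coprime_dvd_left hpa)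
    (Int.natCast_dvd_natCast.1 h3))

/-- If a prime `p` divides the square-free `h` (so `p ∤ a`), a root `ν` of `aν² + h ≡ 0 (mod p^e)`,
`e ≥ 1`, is `≡ 0 (mod p)`, and `e ≥ 2` is impossible (`p² ∣ h`): `ϱ_{a,h}(p^e) ≤ 1`. [folklore] -/
theorem rho_prime_pow_le_one_of_dvd_right {a h p : ℕ} (hp : p.Prime) (hph : p ∣ h)
    (hh : Squarefree h) (hah : a.Coprime h) (e : ℕ) : rho a h (p ^ e) ≤ 1 := by
  rcases Nat.eq_zero_or_pos e with rfl | he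
  · rw [pow_zero]; exact rho_le a h 1
  have hpI : Prime (p : ℤ) := Nat.prime_iff_prime_int.mp hp
  have hpa : ¬(p : ℤ) ∣ (a : ℤ) := fun h' =>
    hp.ne_one (Nat.Coprime.eq_one_of_dvd (hah.coprime_dvd_left (Int.natCast_dvd_natCast.1 h')) hph)
  rw [rho_eq_card_filter]
  refine (card_le_card ?_).trans (card_singleton 0).le
  intro ν hν
  obtain ⟨hνr, hdvd⟩ := mem_filter.mp hν
  rw [mem_range] at hνr
  rw [mem_singleton]
  push_cast at hdvd
  have h1 : (p : ℤ) ∣ (a : ℤ) * (ν : ℤ) ^ 2 + (h : ℤ) := (dvd_pow_self (p : ℤ) he.ne').trans hdvd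
  have h2 : (p : ℤ) ∣ (a : ℤ) * (ν : ℤ) ^ 2 := by
    have := dvd_sub h1 (Int.natCast_dvd_natCast.2 hph)
    rwa [add_sub_cancel_right] at this
  have h3 : (p : ℤ) ∣ (ν : ℤ) := hpI.dvd_of_dvd_pow ((hpI.dvd_or_dvd h2).resolve_left hpa)
  by_contra hν0
  have hpν : p ≤ ν := Nat.le_of_dvd (Nat.pos_of_ne_zero hν0) (Int.natCast_dvd_natCast.1 h3)
  have he2 : 2 ≤ e := by
    by_contra he1
    have he1' : e = 1 := by omega
    rw [he1', pow_one] at hνr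
    omega
  have h6 : (p : ℤ) ^ 2 ∣ (a : ℤ) * (ν : ℤ) ^ 2 + (h : ℤ) := (pow_dvd_pow (p : ℤ) he2).trans hdvd
  have h7 : (p : ℤ) ^ 2 ∣ (a : ℤ) * (ν : ℤ) ^ 2 := (pow_dvd_pow_of_dvd h3 2).mul_left _
  have h8 : (p : ℤ) ^ 2 ∣ (h : ℤ) := by
    have := dvd_sub h6 h7
    rwa [add_sub_cancel_left] at this
  have h9 : p * p ∣ h := by
    have : ((p * p : ℕ) : ℤ) ∣ (h : ℤ) := by push_cast; rwa [← sq]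
    exact Int.natCast_dvd_natCast.1 this
  exact hp.ne_one (Nat.isUnit_iff.1 (hh p h9))

/-- For an odd prime `p ∤ ah`: `ϱ_{a,h}(p^e) ≤ 2`.  Two roots `ν, ν₀` give
`p^e ∣ a(ν - ν₀)(ν + ν₀)`, hence `p^e ∣ (ν - ν₀)(ν + ν₀)`; if `p` divided both factors it would
divide `2ν`, so `ν`, so `h`.  Hence `p^e` divides one factor. [folklore] -/
theorem rho_prime_pow_le_two {a h p : ℕ} (hp : p.Prime) (hp2 : p ≠ 2) (hpa : ¬p ∣ a)
    (hph : ¬p ∣ h) (e : ℕ) : rho a h (p ^ e) ≤ 2 := by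
  rcases Nat.eq_zero_or_pos e with rfl | he
  · exact (rho_le a h _).trans (by norm_num)
  have hpI : Prime (p : ℤ) := Nat.prime_iff_prime_int.mp hp
  have hpaI : ¬(p : ℤ) ∣ (a : ℤ) := fun h' => hpa (Int.natCast_dvd_natCast.1 h')
  have hphI : ¬(p : ℤ) ∣ (h : ℤ) := fun h' => hph (Int.natCast_dvd_natCast.1 h')
  rw [rho_eq_card_filter]
  apply card_le_two_of_dvd_sub_or_add (pow_pos hp.pos e)
  · exact filter_subset _ _
  intro ν hν ν₀ hν₀
  have h1 := (mem_filter.mp hν).2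
  have h2 := (mem_filter.mp hν₀).2
  push_cast at h1 h2 ⊢
  have h3 : (p : ℤ) ^ e ∣ (a : ℤ) * (((ν : ℤ) - ν₀) * ((ν : ℤ) + ν₀)) := by
    have := dvd_sub h1 h2
    have e1 : (a : ℤ) * (ν : ℤ) ^ 2 + (h : ℤ) - ((a : ℤ) * (ν₀ : ℤ) ^ 2 + (h : ℤ)) =
        (a : ℤ) * (((ν : ℤ) - ν₀) * ((ν : ℤ) + ν₀)) := by ring
    rwa [e1] at this
  have hcopa : IsCoprime ((p : ℤ) ^ e) (a : ℤ) :=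
    ((Prime.coprime_iff_not_dvd hpI).mpr hpaI).pow_left
  have h4 : (p : ℤ) ^ e ∣ ((ν : ℤ) - ν₀) * ((ν : ℤ) + ν₀) := hcopa.dvd_of_dvd_mul_left h3
  -- `p` does not divide both factors
  have hnot : ¬((p : ℤ) ∣ (ν : ℤ) - ν₀ ∧ (p : ℤ) ∣ (ν : ℤ) + ν₀) := by
    rintro ⟨ha', hb'⟩
    have h2ν : (p : ℤ) ∣ 2 * ν := by
      have := dvd_add ha' hb'
      have e2 : (ν : ℤ) - ν₀ + ((ν : ℤ) + ν₀) = 2 * ν := by ring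
      rwa [e2] at this
    have hpν : (p : ℤ) ∣ ν := by
      rcases hpI.dvd_or_dvd h2ν with h5 | h5
      · exfalso
        have : (p : ℤ) ≤ 2 := Int.le_of_dvd (by norm_num) h5
        have hp2' : 2 ≤ p := hp.two_le
        omega
      · exact h5
    have hpν2 : (p : ℤ) ∣ (a : ℤ) * (ν : ℤ) ^ 2 := (hpν.pow two_ne_zero).mul_left _
    have hp1 : (p : ℤ) ∣ (a : ℤ) * (ν : ℤ) ^ 2 + (h : ℤ) := (dvd_pow_self (p : ℤ) he.ne').trans h1
    have := dvd_sub hp1 hpν2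
    rw [add_sub_cancel_left] at this
    exact hphI this
  by_cases ha' : (p : ℤ) ∣ (ν : ℤ) + ν₀
  · have hb' : ¬(p : ℤ) ∣ (ν : ℤ) - ν₀ := fun hb' => hnot ⟨hb', ha'⟩
    have hcop : IsCoprime ((p : ℤ) ^ e) ((ν : ℤ) - ν₀) :=
      ((Prime.coprime_iff_not_dvd hpI).mpr hb').pow_left
    exact Or.inr (hcop.dvd_of_dvd_mul_left h4)
  · have hcop : IsCoprime ((p : ℤ) ^ e) ((ν : ℤ) + ν₀) :=
      ((Prime.coprime_iff_not_dvd hpI).mpr ha').pow_left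
    exact Or.inl (hcop.dvd_of_dvd_mul_right h4)

/-- If any two elements `ν, ν₀` of `S ⊆ [0, 2r)` satisfy `r ∣ ν - ν₀` or `r ∣ ν + ν₀`, then
`#S ≤ 4`: the residues `ν mod r` of `S` take at most two values
(`card_le_two_of_dvd_sub_or_add`), and each has at most the two lifts `μ, μ + r`. [folklore] -/
theorem card_le_four_of_dvd_sub_or_add {r : ℕ} (hr : 0 < r) (S : Finset ℕ)
    (hS : S ⊆ range (2 * r))
    (h : ∀ ν ∈ S, ∀ ν₀ ∈ S, (r : ℤ) ∣ (ν : ℤ) - ν₀ ∨ (r : ℤ) ∣ (ν : ℤ) + ν₀) : #S ≤ 4 := by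
  have hmod : ∀ ν : ℕ, (r : ℤ) ∣ (ν : ℤ) - ((ν % r : ℕ) : ℤ) := fun ν =>
    ⟨(ν / r : ℕ), by push_cast; linarith [Int.emod_add_mul_ediv (ν : ℤ) (r : ℤ)]⟩
  have h1 : #S ≤ 2 * #(S.image fun ν => ν % r) := by
    refine card_le_mul_card_image S 2 fun μ _ => ?_
    refine (card_le_card (t := {μ, μ + r}) fun ν hν => ?_).trans card_le_two
    obtain ⟨hνS, hνμ⟩ := mem_filter.mp hν
    have hν2r := mem_range.mp (hS hνS)
    rw [mem_insert, mem_singleton]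
    have hdm := Nat.div_add_mod ν r
    rw [hνμ] at hdm
    set t := ν / r with ht
    have ht2 : t < 2 := by
      rw [ht, Nat.div_lt_iff_lt_mul hr]
      omega
    interval_cases t <;> omega
  have h2 : #(S.image fun ν => ν % r) ≤ 2 := by
    apply card_le_two_of_dvd_sub_or_add hr
    · intro μ hμ
      obtain ⟨ν, -, rfl⟩ := mem_image.mp hμ
      exact mem_range.mpr (Nat.mod_lt ν hr)
    intro μ hμ μ₀ hμ₀
    obtain ⟨ν, hν, rfl⟩ := mem_image.mp hμ
    obtain ⟨ν₀, hν₀, rfl⟩ := mem_image.mp hμ₀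
    rcases h ν hν ν₀ hν₀ with h3 | h3
    · left
      have := dvd_add (dvd_sub h3 (hmod ν)) (hmod ν₀)
      have e1 : (ν : ℤ) - ν₀ - ((ν : ℤ) - ((ν % r : ℕ) : ℤ)) + ((ν₀ : ℤ) - ((ν₀ % r : ℕ) : ℤ)) =
          ((ν % r : ℕ) : ℤ) - ((ν₀ % r : ℕ) : ℤ) := by ring
      rwa [e1] at this
    · right
      have := dvd_sub (dvd_sub h3 (hmod ν)) (hmod ν₀)
      have e1 : (ν : ℤ) + ν₀ - ((ν : ℤ) - ((ν % r : ℕ) : ℤ)) - ((ν₀ : ℤ) - ((ν₀ % r : ℕ) : ℤ)) =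
          ((ν % r : ℕ) : ℤ) + ((ν₀ % r : ℕ) : ℤ) := by ring
      rwa [e1] at this
  calc #S ≤ 2 * #(S.image fun ν => ν % r) := h1
    _ ≤ 2 * 2 := Nat.mul_le_mul_left 2 h2
    _ = 4 := rfl

/-- `2^d ∣ y` from `2^{d+1} ∣ y·x` when `x` is even but not divisible by `4`. [folklore] -/
theorem two_pow_dvd_of_dvd_mul {d : ℕ} {x y : ℤ} (hx : Even x) (hx4 : ¬(4 : ℤ) ∣ x)
    (hxy : (2 : ℤ) ^ (d + 1) ∣ y * x) : (2 : ℤ) ^ d ∣ y := by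
  obtain ⟨w, rfl⟩ := even_iff_two_dvd.mp hx
  have hw : ¬(2 : ℤ) ∣ w := by
    rintro ⟨u, rfl⟩
    exact hx4 ⟨u, by ring⟩
  have h1 : (2 : ℤ) ^ d * 2 ∣ y * w * 2 := by
    have e1 : y * (2 * w) = y * w * 2 := by ring
    rwa [pow_succ, e1] at hxy
  have h2 : (2 : ℤ) ^ d ∣ y * w := (mul_dvd_mul_iff_right two_ne_zero).mp h1
  have hcop : IsCoprime ((2 : ℤ) ^ d) w :=
    ((Prime.coprime_iff_not_dvd Int.prime_two).mpr hw).pow_left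
  exact hcop.dvd_of_dvd_mul_right h2

/-- For `2 ∤ ah`: `ϱ_{a,h}(2^e) ≤ 4`.  Roots are odd; two roots `ν, ν₀` modulo `2^{d+1}` give
`2^{d+1} ∣ (ν - ν₀)(ν + ν₀)` with both factors even and not both divisible by `4` (their sum is
`2ν ≡ 2 (mod 4)`), so `2^d` divides one of them; conclude by `card_le_four_of_dvd_sub_or_add`.
[folklore] -/
theorem rho_two_pow_le_four {a h : ℕ} (ha : ¬2 ∣ a) (hh2 : ¬2 ∣ h) (e : ℕ) :
    rho a h (2 ^ e) ≤ 4 := by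
  rcases Nat.eq_zero_or_pos e with rfl | he
  · exact (rho_le a h _).trans (by norm_num)
  obtain ⟨d, rfl⟩ : ∃ d, e = d + 1 := ⟨e - 1, by omega⟩
  have h2I : Prime (2 : ℤ) := Int.prime_two
  have haI : ¬(2 : ℤ) ∣ (a : ℤ) := fun h' => ha (Int.natCast_dvd_natCast.1 h')
  have hhI : ¬(2 : ℤ) ∣ (h : ℤ) := fun h' => hh2 (Int.natCast_dvd_natCast.1 h')
  rw [rho_eq_card_filter]
  apply card_le_four_of_dvd_sub_or_add (pow_pos two_pos d)
  · rw [← pow_succ']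
    exact filter_subset _ _
  intro ν hν ν₀ hν₀
  have h1 := (mem_filter.mp hν).2
  have h2 := (mem_filter.mp hν₀).2
  push_cast at h1 h2
  -- `2^(d+1) ∣ (ν - ν₀)(ν + ν₀)`
  have h3 : (2 : ℤ) ^ (d + 1) ∣ ((ν : ℤ) - ν₀) * ((ν : ℤ) + ν₀) := by
    have h3' : (2 : ℤ) ^ (d + 1) ∣ (a : ℤ) * (((ν : ℤ) - ν₀) * ((ν : ℤ) + ν₀)) := by
      have := dvd_sub h1 h2
      have e1 : (a : ℤ) * (ν : ℤ) ^ 2 + (h : ℤ) - ((a : ℤ) * (ν₀ : ℤ) ^ 2 + (h : ℤ)) =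
          (a : ℤ) * (((ν : ℤ) - ν₀) * ((ν : ℤ) + ν₀)) := by ring
      rwa [e1] at this
    exact (((Prime.coprime_iff_not_dvd h2I).mpr haI).pow_left).dvd_of_dvd_mul_left h3'
  -- roots are odd
  have hodd : ∀ μ : ℕ, (2 : ℤ) ^ (d + 1) ∣ (a : ℤ) * (μ : ℤ) ^ 2 + (h : ℤ) → Odd (μ : ℤ) := by
    intro μ hμ
    refine Int.not_even_iff_odd.mp fun heven => ?_
    have h2μ : (2 : ℤ) ∣ (μ : ℤ) := even_iff_two_dvd.mp heven
    have h4 : (2 : ℤ) ∣ (a : ℤ) * (μ : ℤ) ^ 2 + (h : ℤ) :=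
      (dvd_pow_self 2 (Nat.succ_ne_zero d)).trans hμ
    have h5 : (2 : ℤ) ∣ (a : ℤ) * (μ : ℤ) ^ 2 := (h2μ.pow two_ne_zero).mul_left _
    have := dvd_sub h4 h5
    rw [add_sub_cancel_left] at this
    exact hhI this
  have hν1 := hodd ν h1
  have hν₀1 := hodd ν₀ h2
  have hsub : Even ((ν : ℤ) - ν₀) := hν1.sub_odd hν₀1
  have hadd : Even ((ν : ℤ) + ν₀) := hν1.add_odd hν₀1
  -- not both divisible by 4
  have hnot : ¬((4 : ℤ) ∣ (ν : ℤ) - ν₀ ∧ (4 : ℤ) ∣ (ν : ℤ) + ν₀) := by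
    rintro ⟨⟨u, hu⟩, ⟨v, hv⟩⟩
    obtain ⟨w, hw⟩ := hν1
    omega
  by_cases h4 : (4 : ℤ) ∣ (ν : ℤ) + ν₀
  · have h4' : ¬(4 : ℤ) ∣ (ν : ℤ) - ν₀ := fun h' => hnot ⟨h', h4⟩
    right
    have h5 : (2 : ℤ) ^ (d + 1) ∣ ((ν : ℤ) + ν₀) * ((ν : ℤ) - ν₀) := by rwa [mul_comm] at h3
    exact_mod_cast two_pow_dvd_of_dvd_mul hsub h4' h5
  · left
    exact_mod_cast two_pow_dvd_of_dvd_mul hadd h4 h3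

/-- **Prime powers**: `ϱ_{a,h}(p^e) ≤ 4` for every prime `p` and every `e`, whenever `h` is
square-free and `gcd(a, h) = 1`. [folklore] -/
theorem rho_prime_pow_le_four {a h p : ℕ} (hp : p.Prime) (hh : Squarefree h) (hah : a.Coprime h)
    (e : ℕ) : rho a h (p ^ e) ≤ 4 := by
  rcases Nat.eq_zero_or_pos e with rfl | he
  · exact (rho_le a h _).trans (by norm_num)
  by_cases hpa : p ∣ a
  · rw [rho_eq_zero_of_prime_dvd hp (dvd_pow_self p he.ne') hpa hah]
    exact Nat.zero_le _
  by_cases hph : p ∣ h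
  · exact (rho_prime_pow_le_one_of_dvd_right hp hph hh hah e).trans (by norm_num)
  by_cases hp2 : p = 2
  · subst hp2
    exact rho_two_pow_le_four hpa hph e
  · exact (rho_prime_pow_le_two hp hp2 hpa hph e).trans (by norm_num)

/-! ### All moduli -/

/-- **`ϱ_{a,h}(k) ≤ τ(k)²`** for every `k`, uniformly in square-free `h` and `a` with
`gcd(a, h) = 1` (multiplicativity and `ϱ_{a,h}(p^e) ≤ 4 ≤ (e + 1)² = τ(p^e)²`).  This is the
"divisor bound for `ϱ`" used throughout [GrimmeltMerikoski2025, §§5–6]. [folklore] -/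
theorem rho_le_card_divisors_sq {a h : ℕ} (hh : Squarefree h) (hah : a.Coprime h) :
    ∀ k : ℕ, rho a h k ≤ #k.divisors ^ 2 := by
  intro k
  induction k using Nat.recOnPosPrimePosCoprime with
  | zero => simp [rho_zero]
  | one => simpa using rho_le a h 1
  | prime_pow p e hp he =>
    rw [card_divisors_prime_pow hp]
    calc rho a h (p ^ e) ≤ 2 ^ 2 := rho_prime_pow_le_four hp hh hah e
      _ ≤ (e + 1) ^ 2 := Nat.pow_le_pow_left (by omega) 2
  | coprime m n _ _ hmn ihm ihn =>
    rw [rho_mul_of_coprime a h hmn, Nat.Coprime.card_divisors_mul hmn, mul_pow]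
    exact Nat.mul_le_mul ihm ihn

/-- **`ϱ_{a,h}(k) ≪_ε k^ε` uniformly**: for every `ε > 0` there is `C ≥ 1` such that
`ϱ_{a,h}(k) ≤ C k^ε` for all `k ≥ 1`, all square-free `h` and all `a` coprime to `h`
(`τ(k) ≤ C' k^{ε/2}`).  The `ϱ ≺≺ 1` of [GrimmeltMerikoski2025, §1.3/§6]. [folklore] -/
theorem exists_rho_le_mul_rpow {ε : ℝ} (hε : 0 < ε) :
    ∃ C : ℝ, 1 ≤ C ∧ ∀ a h k : ℕ, Squarefree h → a.Coprime h → k ≠ 0 →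
      (rho a h k : ℝ) ≤ C * (k : ℝ) ^ ε := by
  obtain ⟨C, hC1, hC⟩ := exists_card_divisors_le_mul_rpow (half_pos hε)
  refine ⟨C ^ 2, one_le_pow₀ hC1, fun a h k hh hah hk => ?_⟩
  have h1 : (rho a h k : ℝ) ≤ (#k.divisors : ℝ) ^ 2 := by
    exact_mod_cast rho_le_card_divisors_sq hh hah k
  have h2 := hC k hk
  have h0 : (0 : ℝ) ≤ #k.divisors := Nat.cast_nonneg _
  have h3 : ((k : ℝ) ^ (ε / 2)) ^ 2 = (k : ℝ) ^ ε := by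
    rw [← Real.rpow_two, ← Real.rpow_mul (Nat.cast_nonneg k)]
    congr 1
    ring
  calc (rho a h k : ℝ) ≤ (#k.divisors : ℝ) ^ 2 := h1
    _ ≤ (C * (k : ℝ) ^ (ε / 2)) ^ 2 := pow_le_pow_left₀ h0 h2 2
    _ = C ^ 2 * (k : ℝ) ^ ε := by rw [mul_pow, h3]

end GM2025

end Literature.NumberTheory.Sieve
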